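import Summits.RiemannHypothesis.RiemannHypothesis.Theorems.SemilocalDeletionGeneralFloor
import Summits.RiemannHypothesis.RiemannHypothesis.Theorems.SemilocalDeletionToeplitzFloor
import Summits.RiemannHypothesis.RiemannHypothesis.Theorems.SemilocalDeletionDipole
import Mathlib.Data.Pi.Interval
import HarnessLib

/-!
# The EXACT joint lag floor: a LATTICE (animal) certificate transfers to the continuum — any primes, any powers

Moving between two finite sets `S → S'` changes the semi-local Weil form on a window `C(c)`, `2c < log (N+1)`, by the signed LAG FORM
`Q_{S'}(g) − Q_S(g) = Σ_{n ≤ N} w_n·(k(log n) + k(−log n))`, `w_n = (Λ_S(n) − Λ_{S'}(n)) n^{-1/2}`, `k = g ⋆ g̃`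
(`SemilocalDeletionGeneralFloor.weilSemilocalQuadratic_sub_eq_sum`).  Every floor proved so far for this form is a ONE-WEIGHT certificate:
the cell decomposition of `…ToeplitzFloor` (one prime, commensurate lags), the Schur/Perron weights of `…SchurFloor`, `…PairFloor`,
`…GeneralFloor` (orbit graphs in finite pieces).  For two or more small primes the lags are INCOMMENSURABLE, every orbit `x + Σ_p ℤ·log p`
is dense in the window, and the orbit graph is an infinite quasi-one-dimensional SLAB of the lattice `ℤ^T`: no cell decomposition exists.

This file proves the exact floor nevertheless, by FØLNER AVERAGING over lattice cubes (§1–§4).  Fix an additive position map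
`P : ℤ^ι → ℝ` (for primes `P(k) = Σ_p k_p·log p`) and shifts `d_n ∈ ℤ^ι` with `P(d_n) = log n` whenever `w_n ≠ 0`.  A **lattice (animal)
certificate with constant `μ`** asks, for every base point `u`, every finite `F ⊂ ℤ^ι` whose positions `u + P(k)` lie in `[−c, c]` (a SLAB
of width `2c`) and every vector `G` supported on `F`:  `0 ≤ μ·Σ_F |G_k|² + Σ_n w_n·Σ_F Re(G_{k+d_n} conj G_k + G_k conj G_{k+d_n})` — every
finite sub-animal of the slab graph has its lag matrix `≥ −μ`.  THEN `Re Q_{S'}(g) ≥ Re Q_S(g) − μ‖g‖₂²` for every Weil test function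
`g ∈ C(c)` (§4 abstract generators, §5 primes with `d_n =` the exponent vector of `n`, any `S, S'`, any `T ⊇` primes of `S ∆ S'`), and
`λ_min(S'; c; P) ≥ λ_min(S; c; P) − μ` (§5).  PROOF: sample `g` along the orbit through `u` on the cube `B = [−R, R]^ι` (`G_u(k) = g(u + P k)`;
positions outside the window carry `g = 0`, so the certificate applies), integrate over `u` (translation invariance turns `Σ_B |G_u|²` into
`|B|‖g‖₂²` and each lag term into the PAIR COUNT `#{k ∈ B : k + d_n ∈ B} = |B|(1 − O(1/R))` times `Re(k(log n) + k(−log n))`), let `R → ∞`.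
No commensurability, no unique factorisation, no measure on the orbit space; `w_n` of either sign.  The converse (every finite animal of
span `< 2c` is ATTAINED by a comb of narrow blocks) is the cell's comb files (`…ToeplitzCombs`, `…PairCombs`, `…Chain`), so the best lattice
constant IS the continuum joint lag floor — the «animal supremum» of cc-s2-1 gen16's STAIRCASE-Z.md §3 (section floors jump exactly at the
spans `½·log n` of new animals).  Nothing here bears on RH; these are statements about truncated Weil forms.
-/

set_option linter.dupNamespace false

noncomputable section

open Complex Filter Set MeasureTheory
open scoped Real Topology ComplexConjugate

namespace Summit.RiemannHypothesis.RiemannHypothesis.Theorems.SemilocalDeletionAnimalFloor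

open Literature.NumberTheory.LFunctions
open Summit.RiemannHypothesis.RiemannHypothesis.Theorems.SemilocalDeletionGeneralFloor
open Summit.RiemannHypothesis.RiemannHypothesis.Theorems.SemilocalDeletionToeplitzFloor
open Summit.RiemannHypothesis.RiemannHypothesis.Theorems.SemilocalDeletionDipole
open Summit.RiemannHypothesis.RiemannHypothesis.Theorems.HandoffSemilocalEnergy

variable {ι : Type*} [Fintype ι] [DecidableEq ι] {g : ℝ → ℂ} {c : ℝ} {N : ℕ}

/-! ## §1  Cubes of the lag lattice `ℤ^ι` and the Bernoulli step -/

/-- `|[−R, R]^ι| = (2R+1)^{|ι|}`. -/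
theorem card_box (R : ℕ) :
    (Finset.Icc (fun _ : ι ↦ -(R : ℤ)) (fun _ ↦ (R : ℤ))).card = (2 * R + 1) ^ Fintype.card ι := by
  rw [Pi.card_Icc]
  have h : ∀ i : ι, (Finset.Icc ((fun _ : ι ↦ -(R : ℤ)) i) ((fun _ : ι ↦ (R : ℤ)) i)).card = 2 * R + 1 := by
    intro i
    rw [Int.card_Icc]
    have : (R : ℤ) + 1 - -(R : ℤ) = ((2 * R + 1 : ℕ) : ℤ) := by push_cast; ring
    rw [this, Int.toNat_natCast]
  rw [Finset.prod_congr rfl fun i _ ↦ h i, Finset.prod_const, Finset.card_univ]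

/-- PAIR COUNT from below: at least `(2R+1)^{|ι|}` points `k` of the cube `[−(R+D), R+D]^ι` have `k + d` in the cube too, for a shift
`d` with entries in `[0, D]` (the small cube `[−R, R]^ι` and its shift both fit). -/
theorem pow_le_card_filter_box {R D : ℕ} {d : ι → ℤ} (hd : ∀ i, 0 ≤ d i ∧ d i ≤ D) :
    (2 * R + 1) ^ Fintype.card ι ≤
      ((Finset.Icc (fun _ : ι ↦ -((R + D : ℕ) : ℤ)) (fun _ ↦ ((R + D : ℕ) : ℤ))).filter
        (fun k ↦ k + d ∈ Finset.Icc (fun _ : ι ↦ -((R + D : ℕ) : ℤ)) (fun _ ↦ ((R + D : ℕ) : ℤ)))).card := by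
  rw [← card_box (ι := ι) R]
  refine Finset.card_le_card fun k hk ↦ ?_
  simp only [Finset.mem_filter, Finset.mem_Icc, Pi.le_def, Pi.add_apply] at hk ⊢
  refine ⟨⟨fun i ↦ ?_, fun i ↦ ?_⟩, ⟨fun i ↦ ?_, fun i ↦ ?_⟩⟩
  all_goals
    have h1 := hk.1 i; have h2 := hk.2 i; have h3 := hd i
    push_cast
    omega

/-- **Limit step** (`R → ∞`): if for every `R` the pair counts `M_n ∈ [(2R+1)^t, (2R+2D+1)^t]` satisfy
`0 ≤ (2R+2D+1)^t·A + Σ_n M_n·x_n`, then `0 ≤ A + Σ_n x_n` (the volume ratio `((2R+1)/(2R+2D+1))^t → 1`). -/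
theorem nonneg_of_forall_box {A : ℝ} {x : ℕ → ℝ} {s : Finset ℕ} {t D : ℕ}
    (h : ∀ R : ℕ, ∃ M : ℕ → ℝ, (∀ n ∈ s, (2 * R + 1 : ℝ) ^ t ≤ M n ∧ M n ≤ (2 * R + 2 * D + 1 : ℝ) ^ t) ∧
      0 ≤ (2 * R + 2 * D + 1 : ℝ) ^ t * A + ∑ n ∈ s, M n * x n) :
    0 ≤ A + ∑ n ∈ s, x n := by
  choose M hM h0 using h
  have hC : ∀ R : ℕ, (0 : ℝ) < (2 * R + 2 * D + 1 : ℝ) ^ t := fun R ↦ by positivity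
  have hden : Tendsto (fun R : ℕ ↦ (2 * R + 2 * D + 1 : ℝ)) atTop atTop := by
    have h2 := (tendsto_natCast_atTop_atTop (R := ℝ)).const_mul_atTop (by norm_num : (0 : ℝ) < 2)
    exact (tendsto_atTop_add_const_right atTop (2 * (D : ℝ) + 1) h2).congr fun R ↦ by ring
  have hr : Tendsto (fun R : ℕ ↦ ((2 * R + 1 : ℝ) / (2 * R + 2 * D + 1)) ^ t) atTop (𝓝 1) := by
    have h1 : Tendsto (fun R : ℕ ↦ 1 - 2 * (D : ℝ) / (2 * R + 2 * D + 1)) atTop (𝓝 1) := by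
      simpa using tendsto_const_nhds.sub (tendsto_const_nhds.div_atTop hden)
    have e : ∀ R : ℕ, ((2 * R + 1 : ℝ) / (2 * R + 2 * D + 1)) = 1 - 2 * (D : ℝ) / (2 * R + 2 * D + 1) := by
      intro R
      have : (2 * R + 2 * D + 1 : ℝ) ≠ 0 := by positivity
      field_simp
      ring
    simpa only [one_pow] using (h1.congr fun R ↦ (e R).symm).pow t
  have ha : ∀ n ∈ s, Tendsto (fun R ↦ M R n / (2 * R + 2 * D + 1 : ℝ) ^ t) atTop (𝓝 1) := by
    intro n hn
    refine tendsto_of_tendsto_of_tendsto_of_le_of_le hr tendsto_const_nhds (fun R ↦ ?_) (fun R ↦ ?_)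
    · rw [div_pow]
      exact div_le_div_of_nonneg_right (hM R n hn).1 (hC R).le
    · exact div_le_one_of_le₀ (hM R n hn).2 (hC R).le
  have hineq : ∀ R, 0 ≤ A + ∑ n ∈ s, M R n / (2 * R + 2 * D + 1 : ℝ) ^ t * x n := by
    intro R
    have := div_nonneg (h0 R) (hC R).le
    rwa [add_div, mul_div_cancel_left₀ _ (hC R).ne', Finset.sum_div,
      Finset.sum_congr rfl fun n _ ↦ mul_div_right_comm (M R n) (x n) _] at this
  have hlim : Tendsto (fun R ↦ A + ∑ n ∈ s, M R n / (2 * R + 2 * D + 1 : ℝ) ^ t * x n) atTop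
      (𝓝 (A + ∑ n ∈ s, 1 * x n)) :=
    tendsto_const_nhds.add (tendsto_finsetSum _ fun n hn ↦ (ha n hn).mul_const _)
  simp only [one_mul] at hlim
  exact ge_of_tendsto' hlim hineq

/-! ## §2  Sampling along an orbit: pointwise, the certificate controls the sampled lattice form -/

omit [DecidableEq ι] in
/-- **Sampled certificate.** Let `P : ℤ^ι → ℝ` be additive (the position map), `tsupport g ⊆ [−c, c]`, and suppose the LATTICE
CERTIFICATE with constant `μ`, weights `w` and shifts `d` holds on every finite configuration whose positions lie in `[−c, c]`.  Then for
every finite `B ⊂ ℤ^ι` and every base point `u`, the lattice form of the sampled vector `k ↦ g(u + P k)` on `B` is nonnegative. -/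
theorem latticeForm_sample_nonneg (hsupp : tsupport g ⊆ Icc (-c) c) (P : (ι → ℤ) → ℝ) (w : ℕ → ℝ) (d : ℕ → ι → ℤ)
    (N : ℕ) {μ : ℝ}
    (hcert : ∀ (u : ℝ) (F : Finset (ι → ℤ)) (G : (ι → ℤ) → ℂ), (∀ k, k ∉ F → G k = 0) →
      (∀ k ∈ F, u + P k ∈ Icc (-c) c) →
      0 ≤ μ * ∑ k ∈ F, ‖G k‖ ^ 2 + ∑ n ∈ Finset.range (N + 1), w n *
        ∑ k ∈ F, (G (k + d n) * conj (G k) + G k * conj (G (k + d n))).re)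
    (B : Finset (ι → ℤ)) (u : ℝ) :
    0 ≤ μ * ∑ k ∈ B, ‖g (u + P k)‖ ^ 2 +
        ∑ n ∈ Finset.range (N + 1), w n * ∑ k ∈ B.filter (fun k ↦ k + d n ∈ B),
          (g (u + P (k + d n)) * conj (g (u + P k)) + g (u + P k) * conj (g (u + P (k + d n)))).re := by
  classical
  set G : (ι → ℤ) → ℂ := fun k ↦ if k ∈ B then g (u + P k) else 0 with hG
  set F := B.filter (fun k ↦ u + P k ∈ Icc (-c) c) with hF
  have hGF : ∀ k, k ∉ F → G k = 0 := by
    intro k hk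
    rw [hF, Finset.mem_filter, not_and] at hk
    by_cases hkB : k ∈ B
    · simp only [hG, if_pos hkB]
      exact apply_eq_zero_of_not_mem hsupp (hk hkB)
    · simp only [hG, if_neg hkB]
  have hFw : ∀ k ∈ F, u + P k ∈ Icc (-c) c := fun k hk ↦ (Finset.mem_filter.1 hk).2
  have h := hcert u F G hGF hFw
  have hsub : F ⊆ B := Finset.filter_subset _ _
  have e1 : ∑ k ∈ F, ‖G k‖ ^ 2 = ∑ k ∈ B, ‖g (u + P k)‖ ^ 2 := by
    rw [Finset.sum_subset hsub (fun k _ hkF ↦ by rw [hGF k hkF, norm_zero, zero_pow two_ne_zero])]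
    exact Finset.sum_congr rfl fun k hk ↦ by simp only [hG, if_pos hk]
  have e2 : ∀ n, ∑ k ∈ F, (G (k + d n) * conj (G k) + G k * conj (G (k + d n))).re =
      ∑ k ∈ B.filter (fun k ↦ k + d n ∈ B),
        (g (u + P (k + d n)) * conj (g (u + P k)) + g (u + P k) * conj (g (u + P (k + d n)))).re := by
    intro n
    rw [Finset.sum_subset hsub (fun k _ hkF ↦ by rw [hGF k hkF]; simp), Finset.sum_filter]
    refine Finset.sum_congr rfl fun k hk ↦ ?_
    by_cases hkd : k + d n ∈ B
    · simp only [hG, if_pos hk, if_pos hkd]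
    · simp only [hG, if_pos hk, if_neg hkd, zero_mul, map_zero, mul_zero, add_zero, Complex.zero_re]
  rw [e1] at h
  simp only [e2] at h
  exact h

/-! ## §3  Integrating over the base point: the Følner averaging identity -/

/-- The two-point integrand of one lag is integrable. -/
theorem integrable_pair (hg : IsWeilTest g) (a b : ℝ) :
    Integrable fun u : ℝ ↦ g (u + (a + b)) * conj (g (u + a)) + g (u + a) * conj (g (u + (a + b))) :=
  (integrable_shift_mul_conj_shift hg (a + b) a).add (integrable_shift_mul_conj_shift hg a (a + b))

/-- **One lag, integrated over the base point**: `∫ Re(g(u+a+b) conj g(u+a) + g(u+a) conj g(u+a+b)) du = Re(k(b) + k(−b))`,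
`k = g ⋆ g̃ = (t ↦ ∫ g(v) conj g(v − t) dv)` (translation invariance of Lebesgue measure). -/
theorem integral_re_pair_eq (hg : IsWeilTest g) (a b : ℝ) :
    ∫ u : ℝ, (g (u + (a + b)) * conj (g (u + a)) + g (u + a) * conj (g (u + (a + b)))).re =
      (weilConv g (weilReflect g) b + weilConv g (weilReflect g) (-b)).re := by
  have hc : ∫ u : ℝ, (g (u + (a + b)) * conj (g (u + a)) + g (u + a) * conj (g (u + (a + b)))) =
      weilConv g (weilReflect g) b + weilConv g (weilReflect g) (-b) := by
    have h1 := integral_add_right_eq_self (μ := volume)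
      (fun v : ℝ ↦ g (v + b) * conj (g v) + g v * conj (g (v + b))) a
    have e : (fun u : ℝ ↦ g (u + (a + b)) * conj (g (u + a)) + g (u + a) * conj (g (u + (a + b)))) =
        fun u : ℝ ↦ g (u + a + b) * conj (g (u + a)) + g (u + a) * conj (g (u + a + b)) := by
      funext u; rw [add_assoc]
    rw [e, h1, weilConv_weilReflect_apply', weilConv_weilReflect_apply']
    have h2 := integral_add_right_eq_self (μ := volume) (fun v : ℝ ↦ g v * conj (g (v - b))) b
    simp only [add_sub_cancel_right] at h2
    have i1 := integrable_shift_mul_conj_shift hg b 0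
    have i2 := integrable_shift_mul_conj_shift hg 0 b
    simp only [add_zero] at i1 i2
    simp only [sub_neg_eq_add]
    rw [← h2]
    exact integral_add i1 i2
  rw [← hc]
  have := integral_re (integrable_pair hg a b)
  simpa only [RCLike.re_to_complex] using this

omit [DecidableEq ι] in
/-- **FØLNER AVERAGING IDENTITY.** For a Weil test function `g`, an additive position map `P : ℤ^ι → ℝ`, real weights `w_n` with
lattice shifts `d_n` (`n ≤ N`), a real `μ` and a finite `B ⊂ ℤ^ι`: integrating over the base point `u` the lattice form of the sampled
vector `k ↦ g(u + P k)` on `B` gives `μ·|B|·‖g‖₂²` plus, for each `n`, the PAIR COUNT `#{k ∈ B : k + d_n ∈ B}` times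
`w_n·Re(k(P d_n) + k(−P d_n))`, `k = g ⋆ g̃`. -/
theorem integral_latticeForm_sample_eq (hg : IsWeilTest g) {P : (ι → ℤ) → ℝ} (hP : ∀ k k', P (k + k') = P k + P k')
    (w : ℕ → ℝ) (d : ℕ → ι → ℤ) (N : ℕ) (μ : ℝ) (B : Finset (ι → ℤ)) :
    ∫ u : ℝ, (μ * ∑ k ∈ B, ‖g (u + P k)‖ ^ 2 +
        ∑ n ∈ Finset.range (N + 1), w n * ∑ k ∈ B.filter (fun k ↦ k + d n ∈ B),
          (g (u + P (k + d n)) * conj (g (u + P k)) + g (u + P k) * conj (g (u + P (k + d n)))).re) =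
      μ * B.card * (∫ u : ℝ, ‖g u‖ ^ 2) +
        ∑ n ∈ Finset.range (N + 1), w n * (B.filter (fun k ↦ k + d n ∈ B)).card *
          (weilConv g (weilReflect g) (P (d n)) + weilConv g (weilReflect g) (-P (d n))).re := by
  -- integrability of every piece
  have hN : ∀ k : ι → ℤ, Integrable fun u : ℝ ↦ ‖g (u + P k)‖ ^ 2 := fun k ↦
    hg.integrable_norm_sq.comp_add_right (P k)
  have hT : ∀ (k : ι → ℤ) (n : ℕ), Integrable fun u : ℝ ↦
      (g (u + P (k + d n)) * conj (g (u + P k)) + g (u + P k) * conj (g (u + P (k + d n)))).re := by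
    intro k n
    rw [hP k (d n)]
    have := (integrable_pair hg (P k) (P (d n))).re
    simpa only [RCLike.re_to_complex] using this
  have hS1 : Integrable fun u : ℝ ↦ μ * ∑ k ∈ B, ‖g (u + P k)‖ ^ 2 :=
    (integrable_finsetSum B fun k _ ↦ hN k).const_mul μ
  have hS2 : ∀ n, Integrable fun u : ℝ ↦ w n * ∑ k ∈ B.filter (fun k ↦ k + d n ∈ B),
      (g (u + P (k + d n)) * conj (g (u + P k)) + g (u + P k) * conj (g (u + P (k + d n)))).re := fun n ↦
    (integrable_finsetSum _ fun k _ ↦ hT k n).const_mul (w n)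
  rw [integral_add hS1 (integrable_finsetSum _ fun n _ ↦ hS2 n), integral_const_mul,
    integral_finsetSum B fun k _ ↦ hN k, integral_finsetSum _ fun n _ ↦ hS2 n]
  congr 1
  · -- the norm part: |B| copies of ‖g‖₂²
    have : ∀ k ∈ B, ∫ u : ℝ, ‖g (u + P k)‖ ^ 2 = ∫ u : ℝ, ‖g u‖ ^ 2 := fun k _ ↦
      integral_add_right_eq_self (μ := volume) (fun u : ℝ ↦ ‖g u‖ ^ 2) (P k)
    rw [Finset.sum_congr rfl this, Finset.sum_const, nsmul_eq_mul]
    ring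
  · refine Finset.sum_congr rfl fun n _ ↦ ?_
    rw [integral_const_mul, integral_finsetSum _ fun k _ ↦ hT k n]
    have : ∀ k ∈ B.filter (fun k ↦ k + d n ∈ B),
        ∫ u : ℝ, (g (u + P (k + d n)) * conj (g (u + P k)) + g (u + P k) * conj (g (u + P (k + d n)))).re =
          (weilConv g (weilReflect g) (P (d n)) + weilConv g (weilReflect g) (-P (d n))).re := by
      intro k _
      rw [hP k (d n)]
      exact integral_re_pair_eq hg (P k) (P (d n))
    rw [Finset.sum_congr rfl this, Finset.sum_const, nsmul_eq_mul]
    ring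

/-! ## §4  THE TRANSFER THEOREM: a lattice certificate is a continuum floor -/

/-- **LATTICE CERTIFICATE ⇒ CONTINUUM FLOOR (abstract generators).**  `S, S'` ANY finite sets, `g ∈ C(c)` a Weil test function,
`2c < log (N+1)`, `P : ℤ^ι → ℝ` additive, shifts `d_n ∈ [0, D]^ι` with `P(d_n) = log n` whenever `w_n = (Λ_S(n) − Λ_{S'}(n)) n^{-1/2} ≠ 0`.
If the lattice certificate with constant `μ` holds on every finite configuration of the slab, then `Re Q_{S'}(g) ≥ Re Q_S(g) − μ‖g‖₂²`. -/
theorem re_weilSemilocalQuadratic_ge_of_latticeCert (hg : IsWeilTest g) (hsupp : tsupport g ⊆ Icc (-c) c)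
    (hN : 2 * c < Real.log ((N : ℝ) + 1)) (S S' : Finset ℕ) {P : (ι → ℤ) → ℝ} (hP : ∀ k k', P (k + k') = P k + P k')
    (d : ℕ → ι → ℤ) {D : ℕ}
    (hdD : ∀ n ∈ Finset.range (N + 1), ∀ i, 0 ≤ d n i ∧ d n i ≤ D)
    (hdlog : ∀ n ∈ Finset.range (N + 1), weilSemilocalCoeff S n - weilSemilocalCoeff S' n ≠ 0 → P (d n) = Real.log n)
    {μ : ℝ}
    (hcert : ∀ (u : ℝ) (F : Finset (ι → ℤ)) (G : (ι → ℤ) → ℂ), (∀ k, k ∉ F → G k = 0) →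
      (∀ k ∈ F, u + P k ∈ Icc (-c) c) →
      0 ≤ μ * ∑ k ∈ F, ‖G k‖ ^ 2 + ∑ n ∈ Finset.range (N + 1), (weilSemilocalCoeff S n - weilSemilocalCoeff S' n) *
        ∑ k ∈ F, (G (k + d n) * conj (G k) + G k * conj (G (k + d n))).re) :
    (weilSemilocalQuadratic S g).re - μ * ∫ u : ℝ, ‖g u‖ ^ 2 ≤ (weilSemilocalQuadratic S' g).re := by
  set w : ℕ → ℝ := fun n ↦ weilSemilocalCoeff S n - weilSemilocalCoeff S' n with hw
  set kk := weilConv g (weilReflect g) with hkk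
  set E := ∫ u : ℝ, ‖g u‖ ^ 2 with hE
  set X : ℕ → ℝ := fun n ↦ (kk (P (d n)) + kk (-P (d n))).re with hX
  -- (1) the exact identity (real part), lags rewritten as lattice shifts: w_n·Re(k(log n)+k(−log n)) = w_n·X_n
  have hid := congrArg Complex.re (weilSemilocalQuadratic_sub_eq_sum hg hsupp hN S S')
  rw [Complex.sub_re, Complex.neg_re, Complex.re_sum] at hid
  have hlag : ∀ n ∈ Finset.range (N + 1),
      (((w n : ℝ) : ℂ) * (kk (Real.log n) + kk (-Real.log n))).re = w n * X n := by
    intro n hn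
    rw [Complex.re_ofReal_mul]
    by_cases h0 : w n = 0
    · rw [h0, zero_mul, zero_mul]
    · simp only [hX, hdlog n hn h0]
  -- (2) for every cube: the averaged inequality
  have hbox : ∀ R : ℕ, ∃ M : ℕ → ℝ, (∀ n ∈ Finset.range (N + 1),
      (2 * R + 1 : ℝ) ^ Fintype.card ι ≤ M n ∧ M n ≤ (2 * R + 2 * D + 1 : ℝ) ^ Fintype.card ι) ∧
      0 ≤ (2 * R + 2 * D + 1 : ℝ) ^ Fintype.card ι * (μ * E) + ∑ n ∈ Finset.range (N + 1), M n * (w n * X n) := by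
    intro R
    set B := Finset.Icc (fun _ : ι ↦ -((R + D : ℕ) : ℤ)) (fun _ ↦ ((R + D : ℕ) : ℤ)) with hB
    refine ⟨fun n ↦ ((B.filter (fun k ↦ k + d n ∈ B)).card : ℝ), fun n hn ↦ ⟨?_, ?_⟩, ?_⟩
    · dsimp only
      have h := pow_le_card_filter_box (ι := ι) (R := R) (hdD n hn)
      rw [← hB] at h
      exact_mod_cast h
    · dsimp only
      have h : (B.filter (fun k ↦ k + d n ∈ B)).card ≤ B.card := Finset.card_filter_le _ _
      rw [hB, card_box (ι := ι) (R + D)] at h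
      have h' : ((B.filter (fun k ↦ k + d n ∈ B)).card : ℝ) ≤ ((2 * (R + D) + 1) ^ Fintype.card ι : ℕ) := by
        exact_mod_cast h
      exact h'.trans_eq (by push_cast; ring)
    · dsimp only
      have hpt := latticeForm_sample_nonneg hsupp P w d N hcert B
      have hint := integral_latticeForm_sample_eq hg hP w d N μ B
      have hpos : 0 ≤ ∫ u : ℝ, (μ * ∑ k ∈ B, ‖g (u + P k)‖ ^ 2 +
          ∑ n ∈ Finset.range (N + 1), w n * ∑ k ∈ B.filter (fun k ↦ k + d n ∈ B),
            (g (u + P (k + d n)) * conj (g (u + P k)) + g (u + P k) * conj (g (u + P (k + d n)))).re) :=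
        integral_nonneg hpt
      rw [hint] at hpos
      have hc : (B.card : ℝ) = (2 * R + 2 * D + 1 : ℝ) ^ Fintype.card ι := by
        rw [hB, card_box (ι := ι) (R + D)]
        push_cast
        ring
      rw [hc] at hpos
      have e : ∑ n ∈ Finset.range (N + 1), w n * ((B.filter (fun k ↦ k + d n ∈ B)).card : ℝ) *
          (kk (P (d n)) + kk (-P (d n))).re =
          ∑ n ∈ Finset.range (N + 1), ((B.filter (fun k ↦ k + d n ∈ B)).card : ℝ) * (w n * X n) :=
        Finset.sum_congr rfl fun n _ ↦ by rw [hX]; ring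
      rw [e] at hpos
      linarith
  -- (3) R → ∞ and assemble
  have hlim := nonneg_of_forall_box hbox
  rw [Finset.sum_congr rfl hlag] at hid
  linarith

/-! ## §5  Primes: generators `log p`, shifts = exponent vectors; the energy form -/

/-- A nonzero weight `Λ_S(n) n^{-1/2} − Λ_{S'}(n) n^{-1/2}` forces `n = p^e` with `p` a prime of `S ∆ S'`; hence for any `T` containing
those primes the exponent vector of `n` on `T` has position `Σ_{q ∈ T} v_q(n)·log q = log n`. -/
theorem sum_factorization_mul_log_eq {S S' T : Finset ℕ} (hT : ∀ p, p.Prime → p ∈ S → p ∉ S' → p ∈ T)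
    (hT' : ∀ p, p.Prime → p ∈ S' → p ∉ S → p ∈ T) {n : ℕ}
    (hw : weilSemilocalCoeff S n - weilSemilocalCoeff S' n ≠ 0) :
    ∑ q : T, (((n.factorization q : ℕ) : ℤ) : ℝ) * Real.log ((q : ℕ) : ℝ) = Real.log n := by
  -- `n` is a prime power whose prime lies in exactly one of `S`, `S'`
  have key : ∃ p e : ℕ, p.Prime ∧ 0 < e ∧ p ^ e = n ∧ p ∈ T := by
    have hpp : ∀ {A B : Finset ℕ}, (∀ p, p.Prime → p ∈ A → p ∉ B → p ∈ T) → n.primeFactors ⊆ A →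
        ¬ n.primeFactors ⊆ B → (ArithmeticFunction.vonMangoldt n : ℝ) / Real.sqrt n ≠ 0 →
        ∃ p e : ℕ, p.Prime ∧ 0 < e ∧ p ^ e = n ∧ p ∈ T := by
      intro A B hAB hA hB hne
      have hΛ : ArithmeticFunction.vonMangoldt n ≠ 0 := fun h0 ↦ hne (by rw [h0]; simp)
      obtain ⟨p, e, hp, he, rfl⟩ := (isPrimePow_nat_iff _).1 (ArithmeticFunction.vonMangoldt_ne_zero_iff.1 hΛ)
      rw [Nat.primeFactors_prime_pow he.ne' hp, Finset.singleton_subset_iff] at hA hB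
      exact ⟨p, e, hp, he, rfl, hAB p hp hA hB⟩
    unfold weilSemilocalCoeff at hw
    by_cases hS : n.primeFactors ⊆ S <;> by_cases hS' : n.primeFactors ⊆ S'
    · rw [if_pos hS, if_pos hS', sub_self] at hw; exact absurd rfl hw
    · rw [if_pos hS, if_neg hS', sub_zero] at hw; exact hpp hT hS hS' hw
    · rw [if_neg hS, if_pos hS', zero_sub, neg_ne_zero] at hw; exact hpp hT' hS' hS hw
    · rw [if_neg hS, if_neg hS', sub_zero] at hw; exact absurd rfl hw
  obtain ⟨p, e, hp, he, rfl, hpT⟩ := key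
  rw [Nat.cast_pow, Real.log_pow, hp.factorization_pow, Finset.sum_eq_single ⟨p, hpT⟩]
  · simp
  · intro q _ hq
    have : (q : ℕ) ≠ p := fun h ↦ hq (Subtype.ext h)
    simp [this.symm]
  · intro h; exact absurd (Finset.mem_univ _) h

/-- **ANIMAL CERTIFICATE ⇒ CONTINUUM FLOOR (primes).**  Let `S, S'` be any two finite sets and `T ⊇` the primes of `S ∆ S'`;
lattice `ℤ^T`, positions `Σ_{p ∈ T} k_p·log p`, shift of the atom `n` = its exponent vector `(v_p(n))_{p ∈ T}`.  If for every base point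
`u`, every finite `F ⊂ ℤ^T` whose positions `u + Σ k_p log p` all lie in `[−c, c]`, and every `G` vanishing off `F`,
`0 ≤ μ·Σ_F |G_k|² + Σ_{n ≤ N} (Λ_S(n) − Λ_{S'}(n)) n^{-1/2}·Σ_F Re(G_{k+v(n)} conj G_k + G_k conj G_{k+v(n)})`,
then `Re Q_{S'}(g) ≥ Re Q_S(g) − μ‖g‖₂²` for every Weil test function `g ∈ C(c)`, `2c < log (N+1)`. -/
theorem re_weilSemilocalQuadratic_ge_of_animalCert {S S' T : Finset ℕ} (hT : ∀ p, p.Prime → p ∈ S → p ∉ S' → p ∈ T)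
    (hT' : ∀ p, p.Prime → p ∈ S' → p ∉ S → p ∈ T) (hg : IsWeilTest g) (hsupp : tsupport g ⊆ Icc (-c) c)
    (hN : 2 * c < Real.log ((N : ℝ) + 1)) {μ : ℝ}
    (hcert : ∀ (u : ℝ) (F : Finset (T → ℤ)) (G : (T → ℤ) → ℂ), (∀ k, k ∉ F → G k = 0) →
      (∀ k ∈ F, u + ∑ p : T, (k p : ℝ) * Real.log ((p : ℕ) : ℝ) ∈ Icc (-c) c) →
      0 ≤ μ * ∑ k ∈ F, ‖G k‖ ^ 2 + ∑ n ∈ Finset.range (N + 1), (weilSemilocalCoeff S n - weilSemilocalCoeff S' n) *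
        ∑ k ∈ F, (G (k + fun p : T ↦ ((n.factorization p : ℕ) : ℤ)) * conj (G k) +
          G k * conj (G (k + fun p : T ↦ ((n.factorization p : ℕ) : ℤ)))).re) :
    (weilSemilocalQuadratic S g).re - μ * ∫ u : ℝ, ‖g u‖ ^ 2 ≤ (weilSemilocalQuadratic S' g).re := by
  refine re_weilSemilocalQuadratic_ge_of_latticeCert hg hsupp hN S S'
    (P := fun k : T → ℤ ↦ ∑ p : T, (k p : ℝ) * Real.log ((p : ℕ) : ℝ)) (fun k k' ↦ ?_)
    (fun n p ↦ ((n.factorization p : ℕ) : ℤ)) (D := N) (fun n hn p ↦ ⟨by positivity, ?_⟩)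
    (fun n _ hw ↦ sum_factorization_mul_log_eq hT hT' hw) hcert
  · simp only [Pi.add_apply, Int.cast_add, add_mul, Finset.sum_add_distrib]
  · have hn : n ≤ N := Nat.lt_succ_iff.1 (Finset.mem_range.1 hn)
    have : n.factorization p ≤ n := by
      rcases Nat.eq_zero_or_pos n with h0 | h0
      · simp [h0]
      · exact (Nat.factorization_lt (p : ℕ) h0.ne').le
    exact_mod_cast this.trans hn

variable {Pc : (ℝ → ℂ) → Prop}

/-- **Energy form.** Under the animal certificate of `re_weilSemilocalQuadratic_ge_of_animalCert` with `μ ≥ 0`: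
`λ_min(S'; c; P) ≥ λ_min(S; c; P) − μ` for every constraint `P` — the JOINT LAG FLOOR of the move `S → S'` is (at most) the best lattice
constant, i.e. the animal supremum. -/
theorem semilocalGroundEnergy_ge_of_animalCert {S S' T : Finset ℕ} (hT : ∀ p, p.Prime → p ∈ S → p ∉ S' → p ∈ T)
    (hT' : ∀ p, p.Prime → p ∈ S' → p ∉ S → p ∈ T) (hN : 2 * c < Real.log ((N : ℝ) + 1)) {μ : ℝ} (hμ : 0 ≤ μ)
    (hcert : ∀ (u : ℝ) (F : Finset (T → ℤ)) (G : (T → ℤ) → ℂ), (∀ k, k ∉ F → G k = 0) →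
      (∀ k ∈ F, u + ∑ p : T, (k p : ℝ) * Real.log ((p : ℕ) : ℝ) ∈ Icc (-c) c) →
      0 ≤ μ * ∑ k ∈ F, ‖G k‖ ^ 2 + ∑ n ∈ Finset.range (N + 1), (weilSemilocalCoeff S n - weilSemilocalCoeff S' n) *
        ∑ k ∈ F, (G (k + fun p : T ↦ ((n.factorization p : ℕ) : ℤ)) * conj (G k) +
          G k * conj (G (k + fun p : T ↦ ((n.factorization p : ℕ) : ℤ)))).re) :
    semilocalGroundEnergy S Pc c - μ ≤ semilocalGroundEnergy S' Pc c := by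
  rcases (semilocalSphereValues S' Pc c).eq_empty_or_nonempty with he | hne
  · have he' : semilocalSphereValues S Pc c = ∅ := by
      rcases (semilocalSphereValues S Pc c).eq_empty_or_nonempty with h0 | h0
      · exact h0
      · have := (semilocalSphereValues_nonempty_iff S Pc c).1 h0
        rw [← semilocalSphereValues_nonempty_iff S' Pc c, he] at this
        exact absurd this Set.not_nonempty_empty
    rw [semilocalGroundEnergy, semilocalGroundEnergy, he, he', Real.sInf_empty]
    linarith
  · refine le_semilocalGroundEnergy hne fun g hg hs hPg hn ↦ ?_
    have h1 := re_weilSemilocalQuadratic_ge_of_animalCert hT hT' hg hs hN hcert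
    have h2 := semilocalGroundEnergy_le_re (S := S) hg hs hPg hn
    rw [hn, mul_one] at h1
    linarith

end Summit.RiemannHypothesis.RiemannHypothesis.Theorems.SemilocalDeletionAnimalFloor



end
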